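import Summits.BirchSwinnertonDyer.BirchSwinnertonDyer.Theorems.KatoDescentPotSupersingularReducibleKatoMemberOfValueInputsNodes
import Summits.BirchSwinnertonDyer.BirchSwinnertonDyer.Theorems.KatoDescentPotSupersingularReducibleUpperOfCountInputsNodes
import Literature.NumberTheory.EllipticCurves.Kato2004.MemberHullCountValueInputs
import HarnessLib

/-!
# Cell `bsd-potss`, routes K9 / K8-t′: crux M `ReducibleKatoMember` (item stmt-BirchSwinnertonDyer-19196,
# node `O6.KatoMemberShaBoundOfReducible`) AND the U₀-red bodies (items 19190 / 19203) FROM ONE PACKAGE —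
# the value-guarded inputs WITH THE TWO PRINTED COUNTS at Kato's member (`Kato2004.MemberHullCountValueInputs`):
# ROUTE-FREE kernel module «shell → exists_memberHullValueInputs» (Literature) and
# «shell → GZK → exists_memberHullCountInputs» (here), hence both nodes

Seat `bsd-potss-rkm` generation 11.  The cell holds two cite-level Kato packages at the member: the
zeta/value family behind crux M (`exists_memberHullZetaInputs`, held child 20278; value-guarded sibling
`exists_memberHullValueInputs`, rkm g10) and kmc's count package behind U₀-red
(`exists_memberHullCountInputs`, held child 19707, which sits on the ORIGINAL `MemberHullInputs` with its
eight now-proved clauses in hypothesis position).  The Literature file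
`Kato2004/MemberHullCountValueInputs.lean` (this seat, STRUCTURE + conversions, no named fact) is their
common refinement: `MemberHullValueInputs` with the composite `count` replaced by kmc's printed counts
(C1)/(C2).  This module supplies the Summits-side kernel:
* `exists_memberCountInputs_of_countValue` — ONE PIN: a count-value package over the lift `𝐲` of a guarded
  `ZetaBody` witness (`κ` cyclotomic, `γ` a topological generator, `p ≠ 2`, `W(ℚ)` and `Ш(W)[p^∞]` finite,
  `L(V,1) ≠ 0` for the curve `V` of the newform) YIELDS kmc's pair `(P : MemberHullInputs, MemberCountInputs
  … P)`: the four value clauses by rkm g10's theorems (`MemberIndexOfValue.not_isOfFinAddOrder_proj_zero_of_zetaBody`,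
  `MemberHullNondegenerate.{ne_zero,constantCoeff_ne_zero}_of_hull_smul`, `MemberHullRankOne.isTorsion_hull_quotient`,
  `IwasawaH2Data.natCard_quotient_span_ne_zero_of_zetaBody`), `finite_coinvariants_H2` by (R0)
  (`IntegralH1RankZero.rank_integralH1_layerZero_le_one`, rkm g9) through
  `MemberHullZetaInputs.finite_coinvariants_H2_of_rank_integralH1_le_one`, the three algebraic clauses and
  `finite_torsion_A` inside the Literature conversions `toMemberHullInputs` / `toMemberCountInputs`;
* **`exists_memberHullCountInputs_of_countValue : shell → rank_eq_analyticRank_of_analyticRank_le_one →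
  Kato2004.exists_memberHullCountInputs`** (fact level; the shell = the hypothesis of the Literature theorem
  `Kato2004.exists_memberHullValueInputs_of_countValue`, displayed verbatim — it is NOT a named fact);
* the nodes from the shell: **`katoMemberShaBoundOfReducible_of_countValue`** (crux M: modularity + shell +
  GZK, through rkm g10's value node) and **`wildUpperReducibleDefect_body_of_countValue`** /
  **`tameUpperReducibleDefect_body_of_countValue`** (U₀-red on K9 / K8-t′, through kmc's bodies), plus the
  sharp member inequality `katoMemberShaBoundSharp_of_countValue` (`2·ord_p #tors`).
So ONE held child with the shell as its text would serve 19196 (both routes) and 19190 / 19203 at once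
(planner's optional consolidation, net debt −1; turnkey in the Literature module docstring).  CONDITIONAL
(audit `proof.conditional`) on the named facts displayed; no item is closed here.  HONEST FRAMING: BSD is
not advanced; nothing is booked; the shell is weaker than print exactly as its two sources.

References: [Kato2004Asterisque] Thm. 12.5–12.6 (pp. 221–222), Lemma 13.10 (1) (p. 230), 13.14 (p. 234),
Thm. 14.5 (p. 236), §14.8 (p. 238), (14.9.3) (p. 240), §14.14 (p. 243), Prop. 14.16 and its proof
(pp. 244–245); [Wuthrich2014] Lemma 14; [GreenbergLNM1716] §3, app. to §4; [Darmon2004] Thm. 3.22;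
[Cassels1965ArithmeticVIII].
-/

set_option autoImplicit false
set_option linter.dupNamespace false

noncomputable section

open scoped NumberField TensorProduct
open Field IsDedekindDomain CongruenceSubgroup Function WeierstrassCurve
open Literature.NumberTheory.GaloisRepresentations
open Literature.NumberTheory.EllipticCurves Literature.NumberTheory.EllipticCurves.ModularForms
open Literature.NumberTheory.EllipticCurves.Kato2004
open Literature.NumberTheory.EllipticCurves.Kato2004.EulerSystemValues Rat.HeightOneSpectrum
open Literature.NumberTheory.EllipticCurves.IwasawaAlgebra
open Literature.NumberTheory.EllipticCurves.Rank1Residual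
open Literature.NumberTheory.EllipticCurves.Rank1Residual.Typed
open Summit.BirchSwinnertonDyer.Rank1Residual.Additive Summit.BirchSwinnertonDyer.Rank1Residual

namespace Summit.BirchSwinnertonDyer.BirchSwinnertonDyer.Theorems.ReducibleOfCountValueInputs

/-! ## One pin: kmc's pair from a count-value package -/

section Pin

variable {W : WeierstrassCurve ℚ} [W.IsElliptic] {p : ℕ} [Fact p.Prime]
  [ContinuousSMul ℤ_[p] (W.tateModule p)] [Module.Free ℤ_[p] (W.tateModule p)]
  [Module.Finite ℤ_[p] (W.tateModule p)] {N : ℕ} [NeZero N] {f : CuspForm (Gamma0 N) 2}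
  {ι : (m : ℕ) → (CyclotomicField m ℚ →+* ℂ)} {κ' : ℝ}
  {Λ : ∀ (k : ℕ) (r : Finset (HeightOneSpectrum (𝓞 ℚ))),
    H1 (tateRep W p) (cycSubgroup p k r) →ₗ[ℤ_[p]] ℚ_[p] ⊗[ℚ] CyclotomicField (cycLevel p k r) ℚ}
  {c d a : ℤ} {A : ℕ}
  {z : ∀ (k : ℕ) (r : (cyclotomicLevelsRat p (badPlaces c d A N)).Ideals),
    H1 (tateRep W p) ((cyclotomicLevelsRat p (badPlaces c d A N)).level k r.1)}
  {x : ∀ (k : ℕ) (r : (cyclotomicLevelsRat p (badPlaces c d A N)).Ideals),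
    CyclotomicField (cycLevel p k r.1) ℚ}
  {V : WeierstrassCurve ℚ} [V.IsElliptic]
  {κ : ZpExtension ℚ p} {γ : absoluteGaloisGroup ℚ} {I : IwasawaH1Data W p κ γ} {y : I.H}

/-- **One pin: a count-value package over the lift of a guarded `ZetaBody` witness YIELDS kmc's pair
`(P : MemberHullInputs, C : MemberCountInputs … P)`** (`κ` cyclotomic, `γ` a topological generator, `p` odd,
`W(ℚ)` and `Ш(W)[p^∞]` finite; `κ′ ≠ 0`, `f` the newform of a curve `V` with `L(V,1) ≠ 0`, `(cd, A) = 1`,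
`dd′ ≡ 1 (A)`, `cuspFactor f true 1 c d a A d′ ≠ 0`): the clauses `z_ne_zero`, `isTorsion_quotient`,
`lam_constantCoeff_ne_zero`, `index_ne_zero` by the value theorems of rkm g10, `finite_coinvariants_H2` by
(R0), `finite_H` / `torsionFree_H` / `ι_injective` / `finite_torsion_A` inside the Literature conversions.
[cite: Kato2004Asterisque, Thm. 12.5 (1)(2) (pp. 221–222), Lemma 13.10 (1) (p. 230), Thm. 14.5 (1)(2) (p. 236), §14.14 (14.14.1)–(14.14.2) (p. 243)] -/
theorem exists_memberCountInputs_of_countValue (Q : MemberHullCountValueInputs W p κ γ I y)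
    [Finite W.toAffine.Point] [Finite (AddCommGroup.primaryComponent W.sha p)]
    (hκ : κ.IsCyclotomic) (hγ : κ.IsTopGenerator γ) (hp : p ≠ 2)
    (hbody : ZetaBody W p f ι κ' Λ c d a A z x) (hκ' : κ' ≠ 0)
    (hf : IsNewformOf V f) (hL1 : V.entireLFunction 1 ≠ 0) (hA : 0 < A) (d' : ℤ)
    (hcd : Int.gcd (c * d) A = 1) (hdd' : d * d' ≡ 1 [ZMOD (A : ℤ)])
    (hR : cuspFactor f true (fun _ ↦ 1) c d a A d' ≠ 0)
    (hy : ∀ n : ℕ, I.proj n y = levelToLayer W p hκ hp (badPlaces c d A N) n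
      (z (n + 1) (cyclotomicLevelsRat p (badPlaces c d A N)).idealOne)) :
    ∃ P : MemberHullInputs W p κ γ I y, Nonempty (MemberCountInputs W p κ γ I y P) := by
  haveI := Q.torsionFree_F
  haveI := Q.finite_F
  have hnt : ¬ IsOfFinAddOrder (I.proj 0 y) :=
    MemberIndexOfValue.not_isOfFinAddOrder_proj_zero_of_zetaBody hκ hp hbody hκ' hf hL1 hA d' hcd hdd' hR hy
  have hz : Q.z ≠ 0 := MemberHullNondegenerate.ne_zero_of_hull_smul I Q.j Q.j_injective Q.j_y hnt
  have hT : Module.IsTorsion (IwasawaAlgebra p) (Q.F ⧸ (IwasawaAlgebra p) ∙ Q.z) :=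
    MemberHullRankOne.isTorsion_hull_quotient hκ hγ I Q.j Q.j_injective Q.finite_coker hz
  have hlam : PowerSeries.constantCoeff Q.lam ≠ 0 :=
    MemberHullNondegenerate.constantCoeff_ne_zero_of_hull_smul I Q.j Q.j_injective Q.finite_coker Q.j_y hnt
  have hidx : Nat.card (Q.A ⧸ (IwasawaAlgebra p) ∙ Q.ι (Submodule.Quotient.mk y)) ≠ 0 :=
    MemberIndexOfValue.IwasawaH2Data.natCard_quotient_span_ne_zero_of_zetaBody
      (Q.toMemberHullValueInputs.toIwasawaH2Data hκ hγ) hκ hp hbody hκ' hf hL1 hA d' hcd hdd' hR hy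
  have hH2 : Finite (coinvariants p Q.H2) :=
    (Q.toMemberHullValueInputs.toMemberHullZetaInputs hz hT hlam hidx).finite_coinvariants_H2_of_rank_integralH1_le_one
      hκ hγ (IntegralH1RankZero.rank_integralH1_layerZero_le_one W p κ)
  exact ⟨Q.toMemberHullInputs hκ hγ hz hT hlam hidx hH2, ⟨Q.toMemberCountInputs hκ hγ hz hT hlam hidx hH2⟩⟩

end Pin

/-! ## Fact level: kmc's held input from the shell, and the nodes -/

/-- **KERNEL: kmc's held input from the count-value shell** —
`shell → rank_eq_analyticRank_of_analyticRank_le_one → Kato2004.exists_memberHullCountInputs`, the shell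
being VERBATIM the hypothesis of `Kato2004.exists_memberHullValueInputs_of_countValue` (the value-guarded
`∀∃` text with `MemberHullCountValueInputs`; not a named fact).  On each pin of the member `W_K`: `W_K(ℚ)`
finite (analytic rank `0`, GZK at `W`, `mordellWeilRank_eq_zero_iff_finite`, `finite_point_of_isIsogenous`),
`Ш(W_K)` finite (`IsIsogenous.shaFinite_iff_shaFinite`), then `exists_memberCountInputs_of_countValue`
with the displayed guard of the witness clause (the guard itself is dropped from the conclusion's text).
[cite: Kato2004Asterisque, Thm. 12.5 (1)(2) (pp. 221–222), Lemma 13.10 (1) (p. 230), Thm. 14.5 (1)(2) (p. 236), §14.14 (14.14.1)–(14.14.2) (p. 243), proof of Prop. 14.16 (pp. 244–245)]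
[cite: Darmon2004, Thm. 3.22] -/
theorem exists_memberHullCountInputs_of_countValue
    (h : ∀ (W : WeierstrassCurve ℚ) [W.IsElliptic] [W.IsGloballyMinimal] (p : ℕ) [Fact p.Prime]
      (hp : p ≠ 2),
      ¬ W.HasGoodReductionAtPrime p → ¬ W.HasMultiplicativeReductionAtPrime p →
      0 ≤ padicValRat p W.j →
      ¬ W.HasIrreducibleModPGaloisRep p →
      W.entireLFunction 1 ≠ 0 → Finite W.sha →
      ∃ (W' : WeierstrassCurve ℚ) (_ : W'.IsElliptic) (_ : W'.IsGloballyMinimal),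
        WeierstrassCurve.IsIsogenous W W' ∧
        ∀ [ContinuousSMul ℤ_[p] (W'.tateModule p)] [Module.Free ℤ_[p] (W'.tateModule p)]
          [Module.Finite ℤ_[p] (W'.tateModule p)],
        ∀ {N : ℕ} [NeZero N] (f : CuspForm (Gamma0 N) 2), IsNewformOf W f →
        ∀ (ι : (m : ℕ) → (CyclotomicField m ℚ →+* ℂ)),
        ∃ (κ' : ℝ) (Λ' : ∀ (k : ℕ) (r : Finset (HeightOneSpectrum (𝓞 ℚ))),
            H1 (tateRep W' p) (cycSubgroup p k r) →ₗ[ℤ_[p]] ℚ_[p] ⊗[ℚ] CyclotomicField (cycLevel p k r) ℚ)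
          (c d a : ℤ) (A : ℕ)
          (z : ∀ (k : ℕ) (r : (cyclotomicLevelsRat p (badPlaces c d A N)).Ideals),
            H1 (tateRep W' p) ((cyclotomicLevelsRat p (badPlaces c d A N)).level k r.1))
          (x : ∀ (k : ℕ) (r : (cyclotomicLevelsRat p (badPlaces c d A N)).Ideals),
            CyclotomicField (cycLevel p k r.1) ℚ),
          κ' ≠ 0 ∧ 0 < A ∧ Int.gcd c (6 * p * A) = 1 ∧ Int.gcd d (6 * p * N) = 1 ∧
          Int.gcd (c * d) A = 1 ∧
          (∃ d' : ℤ, d * d' ≡ 1 [ZMOD (A : ℤ)] ∧ cuspFactor f true (fun _ ↦ 1) c d a A d' ≠ 0) ∧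
          ZetaBody W' p f ι κ' Λ' c d a A z x ∧
          ∀ (κ : ZpExtension ℚ p) (γ : absoluteGaloisGroup ℚ) (hκ : κ.IsCyclotomic),
            κ.IsTopGenerator γ →
            ∀ (I : IwasawaH1Data W' p κ γ) (y : I.H),
              (∀ n : ℕ, I.proj n y = levelToLayer W' p hκ hp (badPlaces c d A N) n
                (z (n + 1) (cyclotomicLevelsRat p (badPlaces c d A N)).idealOne)) →
              Nonempty (MemberHullCountValueInputs W' p κ γ I y))
    (hGZK : rank_eq_analyticRank_of_analyticRank_le_one) : Kato2004.exists_memberHullCountInputs := by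
  intro W _ _ p _ hp hgood hmult hj hirr hL hsha
  obtain ⟨W', hW'e, hW'm, hiso, hrest⟩ := h W p hp hgood hmult hj hirr hL hsha
  haveI := hW'e
  have h0 : W.analyticRank = 0 :=
    Summit.BirchSwinnertonDyer.Rank1Residual.O5.analyticRank_eq_zero_of_entireLFunction_one_ne_zero W hL
  obtain ⟨hrk, -⟩ := hGZK W (by rw [h0]; exact zero_le_one)
  rw [h0] at hrk
  haveI hWfin : Finite W.toAffine.Point := (W.mordellWeilRank_eq_zero_iff_finite).mp hrk
  haveI hW'fin : Finite W'.toAffine.Point := finite_point_of_isIsogenous hiso.symm_of_isElliptic hWfin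
  have hshaW' : W'.ShaFinite := hiso.shaFinite_iff_shaFinite.mp hsha
  haveI : Finite W'.sha := hshaW'
  refine ⟨W', hW'e, hW'm, hiso, ?_⟩
  intro _ _ _ N _ f hf ι
  obtain ⟨κ', Λ', c, d, a, A, z, x, hκ', hA, hc, hd, hcd, ⟨d', hdd', hR⟩, hZB, hall⟩ := hrest f hf ι
  refine ⟨κ', Λ', c, d, a, A, z, x, hκ', hA, hc, hd, hZB, ?_⟩
  intro κ γ hκ hγ I y hy
  obtain ⟨Q⟩ := hall κ γ hκ hγ I y hy
  exact exists_memberCountInputs_of_countValue Q hκ hγ hp hZB hκ' hf hL hA d' hcd hdd' hR hy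

/-- **The node T-X3K = crux M from the count-value shell**: `exists_isNewformOf → shell →
rank_eq_analyticRank_of_analyticRank_le_one → O6.KatoMemberShaBoundOfReducible` — forget the counts
(`Kato2004.exists_memberHullValueInputs_of_countValue`) and apply rkm g10's value node.  Conditional on
the named facts; nothing else assumed.
[cite: Kato2004Asterisque, Thm. 12.6 (p. 222), §14.14 and Lemma 14.15 (pp. 243–244), Prop. 14.16 (2) (p. 244)]
[cite: Wuthrich2014, Lemma 14 (p. 396)] [cite: Darmon2004, Thm. 3.22] -/
theorem katoMemberShaBoundOfReducible_of_countValue (hmod : exists_isNewformOf)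
    (h : ∀ (W : WeierstrassCurve ℚ) [W.IsElliptic] [W.IsGloballyMinimal] (p : ℕ) [Fact p.Prime]
      (hp : p ≠ 2),
      ¬ W.HasGoodReductionAtPrime p → ¬ W.HasMultiplicativeReductionAtPrime p →
      0 ≤ padicValRat p W.j →
      ¬ W.HasIrreducibleModPGaloisRep p →
      W.entireLFunction 1 ≠ 0 → Finite W.sha →
      ∃ (W' : WeierstrassCurve ℚ) (_ : W'.IsElliptic) (_ : W'.IsGloballyMinimal),
        WeierstrassCurve.IsIsogenous W W' ∧
        ∀ [ContinuousSMul ℤ_[p] (W'.tateModule p)] [Module.Free ℤ_[p] (W'.tateModule p)]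
          [Module.Finite ℤ_[p] (W'.tateModule p)],
        ∀ {N : ℕ} [NeZero N] (f : CuspForm (Gamma0 N) 2), IsNewformOf W f →
        ∀ (ι : (m : ℕ) → (CyclotomicField m ℚ →+* ℂ)),
        ∃ (κ' : ℝ) (Λ' : ∀ (k : ℕ) (r : Finset (HeightOneSpectrum (𝓞 ℚ))),
            H1 (tateRep W' p) (cycSubgroup p k r) →ₗ[ℤ_[p]] ℚ_[p] ⊗[ℚ] CyclotomicField (cycLevel p k r) ℚ)
          (c d a : ℤ) (A : ℕ)
          (z : ∀ (k : ℕ) (r : (cyclotomicLevelsRat p (badPlaces c d A N)).Ideals),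
            H1 (tateRep W' p) ((cyclotomicLevelsRat p (badPlaces c d A N)).level k r.1))
          (x : ∀ (k : ℕ) (r : (cyclotomicLevelsRat p (badPlaces c d A N)).Ideals),
            CyclotomicField (cycLevel p k r.1) ℚ),
          κ' ≠ 0 ∧ 0 < A ∧ Int.gcd c (6 * p * A) = 1 ∧ Int.gcd d (6 * p * N) = 1 ∧
          Int.gcd (c * d) A = 1 ∧
          (∃ d' : ℤ, d * d' ≡ 1 [ZMOD (A : ℤ)] ∧ cuspFactor f true (fun _ ↦ 1) c d a A d' ≠ 0) ∧
          ZetaBody W' p f ι κ' Λ' c d a A z x ∧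
          ∀ (κ : ZpExtension ℚ p) (γ : absoluteGaloisGroup ℚ) (hκ : κ.IsCyclotomic),
            κ.IsTopGenerator γ →
            ∀ (I : IwasawaH1Data W' p κ γ) (y : I.H),
              (∀ n : ℕ, I.proj n y = levelToLayer W' p hκ hp (badPlaces c d A N) n
                (z (n + 1) (cyclotomicLevelsRat p (badPlaces c d A N)).idealOne)) →
              Nonempty (MemberHullCountValueInputs W' p κ γ I y))
    (hGZK : rank_eq_analyticRank_of_analyticRank_le_one) :
    Summit.BirchSwinnertonDyer.Rank1Residual.O6.KatoMemberShaBoundOfReducible :=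
  ReducibleOfValueInputs.katoMemberShaBoundOfReducible_of_memberHullValueInputs hmod
    (Kato2004.exists_memberHullValueInputs_of_countValue h) hGZK

/-- **The SHARP member bound (`2·ord_p #tors`) from the count-value shell** — kmc's
`ReducibleUpperOfCountInputs.katoMemberShaBoundSharp_of_memberCountInputs` fed with
`exists_memberHullCountInputs_of_countValue` (`nonempty_iwasawaH1Data` by its `_holds`).  Conditional on
the named facts; nothing else assumed.
[cite: Kato2004Asterisque, proof of Prop. 14.16 (pp. 244–245), §14.14 and Lemma 14.15 (pp. 243–244)]
[cite: GreenbergLNM1716, §3 and appendix to §4] [cite: Wuthrich2014, Lemma 14 (p. 396)] -/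
theorem katoMemberShaBoundSharp_of_countValue (hmod : exists_isNewformOf)
    (h : ∀ (W : WeierstrassCurve ℚ) [W.IsElliptic] [W.IsGloballyMinimal] (p : ℕ) [Fact p.Prime]
      (hp : p ≠ 2),
      ¬ W.HasGoodReductionAtPrime p → ¬ W.HasMultiplicativeReductionAtPrime p →
      0 ≤ padicValRat p W.j →
      ¬ W.HasIrreducibleModPGaloisRep p →
      W.entireLFunction 1 ≠ 0 → Finite W.sha →
      ∃ (W' : WeierstrassCurve ℚ) (_ : W'.IsElliptic) (_ : W'.IsGloballyMinimal),
        WeierstrassCurve.IsIsogenous W W' ∧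
        ∀ [ContinuousSMul ℤ_[p] (W'.tateModule p)] [Module.Free ℤ_[p] (W'.tateModule p)]
          [Module.Finite ℤ_[p] (W'.tateModule p)],
        ∀ {N : ℕ} [NeZero N] (f : CuspForm (Gamma0 N) 2), IsNewformOf W f →
        ∀ (ι : (m : ℕ) → (CyclotomicField m ℚ →+* ℂ)),
        ∃ (κ' : ℝ) (Λ' : ∀ (k : ℕ) (r : Finset (HeightOneSpectrum (𝓞 ℚ))),
            H1 (tateRep W' p) (cycSubgroup p k r) →ₗ[ℤ_[p]] ℚ_[p] ⊗[ℚ] CyclotomicField (cycLevel p k r) ℚ)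
          (c d a : ℤ) (A : ℕ)
          (z : ∀ (k : ℕ) (r : (cyclotomicLevelsRat p (badPlaces c d A N)).Ideals),
            H1 (tateRep W' p) ((cyclotomicLevelsRat p (badPlaces c d A N)).level k r.1))
          (x : ∀ (k : ℕ) (r : (cyclotomicLevelsRat p (badPlaces c d A N)).Ideals),
            CyclotomicField (cycLevel p k r.1) ℚ),
          κ' ≠ 0 ∧ 0 < A ∧ Int.gcd c (6 * p * A) = 1 ∧ Int.gcd d (6 * p * N) = 1 ∧
          Int.gcd (c * d) A = 1 ∧
          (∃ d' : ℤ, d * d' ≡ 1 [ZMOD (A : ℤ)] ∧ cuspFactor f true (fun _ ↦ 1) c d a A d' ≠ 0) ∧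
          ZetaBody W' p f ι κ' Λ' c d a A z x ∧
          ∀ (κ : ZpExtension ℚ p) (γ : absoluteGaloisGroup ℚ) (hκ : κ.IsCyclotomic),
            κ.IsTopGenerator γ →
            ∀ (I : IwasawaH1Data W' p κ γ) (y : I.H),
              (∀ n : ℕ, I.proj n y = levelToLayer W' p hκ hp (badPlaces c d A N) n
                (z (n + 1) (cyclotomicLevelsRat p (badPlaces c d A N)).idealOne)) →
              Nonempty (MemberHullCountValueInputs W' p κ γ I y))
    (hGZK : rank_eq_analyticRank_of_analyticRank_le_one)
    (W : WeierstrassCurve ℚ) [W.IsElliptic] [W.IsGloballyMinimal] (p : ℕ) [Fact p.Prime]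
    (hp : p ≠ 2) (hng : ¬ W.HasGoodReductionAtPrime p) (hnm : ¬ W.HasMultiplicativeReductionAtPrime p)
    (hj : 0 ≤ padicValRat p W.j) (hred : ¬ W.HasIrreducibleModPGaloisRep p)
    (hL : W.entireLFunction 1 ≠ 0) (hfin : Finite W.sha) :
    ∃ (W' : WeierstrassCurve ℚ) (_ : W'.IsElliptic) (_ : W'.IsGloballyMinimal),
      IsIsogenous W W' ∧ Finite W'.sha ∧
      ∃ q : ℚ, W'.entireLFunction 1 / (W'.realPeriodRat : ℂ) = (q : ℂ) ∧
        (padicValNat p (Nat.card (AddCommGroup.primaryComponent W'.sha p)) : ℤ) +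
            padicValNat p W'.tamagawaProduct ≤
          padicValRat p q + 2 * (padicValNat p W'.torsionOrder : ℤ) :=
  ReducibleUpperOfCountInputs.katoMemberShaBoundSharp_of_memberCountInputs
    Kato2004.nonempty_iwasawaH1Data_holds hmod (exists_memberHullCountInputs_of_countValue h hGZK)
    W p hp hng hnm hj hred hL hfin

/-- **BODY of the K9 item `WildUpperReducibleDefect` (stmt 19190) from the count-value shell** — kmc's
`ReducibleUpperOfCountInputs.wildUpperReducibleDefect_body` fed with
`exists_memberHullCountInputs_of_countValue` (`nonempty_iwasawaH1Data` by its `_holds`).  Conditional on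
the named facts (shell, modularity ×2, Cassels, GZK); nothing else assumed.
[cite: Kato2004Asterisque, proof of Prop. 14.16 (pp. 244–245), §14.14 (p. 243)] [cite: Cassels1965ArithmeticVIII] -/
theorem wildUpperReducibleDefect_body_of_countValue (hmod : exists_isNewformOf)
    (h : ∀ (W : WeierstrassCurve ℚ) [W.IsElliptic] [W.IsGloballyMinimal] (p : ℕ) [Fact p.Prime]
      (hp : p ≠ 2),
      ¬ W.HasGoodReductionAtPrime p → ¬ W.HasMultiplicativeReductionAtPrime p →
      0 ≤ padicValRat p W.j →
      ¬ W.HasIrreducibleModPGaloisRep p →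
      W.entireLFunction 1 ≠ 0 → Finite W.sha →
      ∃ (W' : WeierstrassCurve ℚ) (_ : W'.IsElliptic) (_ : W'.IsGloballyMinimal),
        WeierstrassCurve.IsIsogenous W W' ∧
        ∀ [ContinuousSMul ℤ_[p] (W'.tateModule p)] [Module.Free ℤ_[p] (W'.tateModule p)]
          [Module.Finite ℤ_[p] (W'.tateModule p)],
        ∀ {N : ℕ} [NeZero N] (f : CuspForm (Gamma0 N) 2), IsNewformOf W f →
        ∀ (ι : (m : ℕ) → (CyclotomicField m ℚ →+* ℂ)),
        ∃ (κ' : ℝ) (Λ' : ∀ (k : ℕ) (r : Finset (HeightOneSpectrum (𝓞 ℚ))),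
            H1 (tateRep W' p) (cycSubgroup p k r) →ₗ[ℤ_[p]] ℚ_[p] ⊗[ℚ] CyclotomicField (cycLevel p k r) ℚ)
          (c d a : ℤ) (A : ℕ)
          (z : ∀ (k : ℕ) (r : (cyclotomicLevelsRat p (badPlaces c d A N)).Ideals),
            H1 (tateRep W' p) ((cyclotomicLevelsRat p (badPlaces c d A N)).level k r.1))
          (x : ∀ (k : ℕ) (r : (cyclotomicLevelsRat p (badPlaces c d A N)).Ideals),
            CyclotomicField (cycLevel p k r.1) ℚ),
          κ' ≠ 0 ∧ 0 < A ∧ Int.gcd c (6 * p * A) = 1 ∧ Int.gcd d (6 * p * N) = 1 ∧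
          Int.gcd (c * d) A = 1 ∧
          (∃ d' : ℤ, d * d' ≡ 1 [ZMOD (A : ℤ)] ∧ cuspFactor f true (fun _ ↦ 1) c d a A d' ≠ 0) ∧
          ZetaBody W' p f ι κ' Λ' c d a A z x ∧
          ∀ (κ : ZpExtension ℚ p) (γ : absoluteGaloisGroup ℚ) (hκ : κ.IsCyclotomic),
            κ.IsTopGenerator γ →
            ∀ (I : IwasawaH1Data W' p κ γ) (y : I.H),
              (∀ n : ℕ, I.proj n y = levelToLayer W' p hκ hp (badPlaces c d A N) n
                (z (n + 1) (cyclotomicLevelsRat p (badPlaces c d A N)).idealOne)) →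
              Nonempty (MemberHullCountValueInputs W' p κ γ I y))
    (hCassels : bsdRHS_eq_of_isIsogenous) (hGZK : rank_eq_analyticRank_of_analyticRank_le_one)
    (hmodL : hasEntireLFunction_rat) :
    ∀ (W : WeierstrassCurve ℚ) [W.IsElliptic] [W.IsGloballyMinimal] [Fact (3 : ℕ).Prime],
      W.analyticRank = 0 → ClassO6 W 3 → ¬ W.HasIrreducibleModPGaloisRep 3 →
      ¬ ((∀ (W' : WeierstrassCurve ℚ) [W'.IsElliptic], IsIsogenous W W' → ¬ 3 ^ 2 ∣ W'.torsionOrder) ∧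
          ∀ q : ℚ, shaAn W = (q : ℂ) → Even (padicValRat 3 q)) →
      MissingUpperBoundAt W 3 :=
  ReducibleUpperOfCountInputs.wildUpperReducibleDefect_body Kato2004.nonempty_iwasawaH1Data_holds hmod
    (exists_memberHullCountInputs_of_countValue h hGZK) hCassels hGZK hmodL

/-- **BODY of the K8-t′ item `TameUpperReducibleDefect` (stmt 19203) from the count-value shell** — kmc's
`ReducibleUpperOfCountInputs.tameUpperReducibleDefect_body` fed with
`exists_memberHullCountInputs_of_countValue`.  Conditional on the named facts; nothing else assumed.
[cite: Kato2004Asterisque, proof of Prop. 14.16 (pp. 244–245), §14.14 (p. 243)] [cite: Cassels1965ArithmeticVIII] -/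
theorem tameUpperReducibleDefect_body_of_countValue (hmod : exists_isNewformOf)
    (h : ∀ (W : WeierstrassCurve ℚ) [W.IsElliptic] [W.IsGloballyMinimal] (p : ℕ) [Fact p.Prime]
      (hp : p ≠ 2),
      ¬ W.HasGoodReductionAtPrime p → ¬ W.HasMultiplicativeReductionAtPrime p →
      0 ≤ padicValRat p W.j →
      ¬ W.HasIrreducibleModPGaloisRep p →
      W.entireLFunction 1 ≠ 0 → Finite W.sha →
      ∃ (W' : WeierstrassCurve ℚ) (_ : W'.IsElliptic) (_ : W'.IsGloballyMinimal),
        WeierstrassCurve.IsIsogenous W W' ∧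
        ∀ [ContinuousSMul ℤ_[p] (W'.tateModule p)] [Module.Free ℤ_[p] (W'.tateModule p)]
          [Module.Finite ℤ_[p] (W'.tateModule p)],
        ∀ {N : ℕ} [NeZero N] (f : CuspForm (Gamma0 N) 2), IsNewformOf W f →
        ∀ (ι : (m : ℕ) → (CyclotomicField m ℚ →+* ℂ)),
        ∃ (κ' : ℝ) (Λ' : ∀ (k : ℕ) (r : Finset (HeightOneSpectrum (𝓞 ℚ))),
            H1 (tateRep W' p) (cycSubgroup p k r) →ₗ[ℤ_[p]] ℚ_[p] ⊗[ℚ] CyclotomicField (cycLevel p k r) ℚ)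
          (c d a : ℤ) (A : ℕ)
          (z : ∀ (k : ℕ) (r : (cyclotomicLevelsRat p (badPlaces c d A N)).Ideals),
            H1 (tateRep W' p) ((cyclotomicLevelsRat p (badPlaces c d A N)).level k r.1))
          (x : ∀ (k : ℕ) (r : (cyclotomicLevelsRat p (badPlaces c d A N)).Ideals),
            CyclotomicField (cycLevel p k r.1) ℚ),
          κ' ≠ 0 ∧ 0 < A ∧ Int.gcd c (6 * p * A) = 1 ∧ Int.gcd d (6 * p * N) = 1 ∧
          Int.gcd (c * d) A = 1 ∧
          (∃ d' : ℤ, d * d' ≡ 1 [ZMOD (A : ℤ)] ∧ cuspFactor f true (fun _ ↦ 1) c d a A d' ≠ 0) ∧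
          ZetaBody W' p f ι κ' Λ' c d a A z x ∧
          ∀ (κ : ZpExtension ℚ p) (γ : absoluteGaloisGroup ℚ) (hκ : κ.IsCyclotomic),
            κ.IsTopGenerator γ →
            ∀ (I : IwasawaH1Data W' p κ γ) (y : I.H),
              (∀ n : ℕ, I.proj n y = levelToLayer W' p hκ hp (badPlaces c d A N) n
                (z (n + 1) (cyclotomicLevelsRat p (badPlaces c d A N)).idealOne)) →
              Nonempty (MemberHullCountValueInputs W' p κ γ I y))
    (hCassels : bsdRHS_eq_of_isIsogenous) (hGZK : rank_eq_analyticRank_of_analyticRank_le_one)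
    (hmodL : hasEntireLFunction_rat) :
    ∀ (W : WeierstrassCurve ℚ) [W.IsElliptic] [W.IsGloballyMinimal] (p : ℕ) [Fact p.Prime],
      W.analyticRank = 0 → p ≠ 2 → Addv W p → SubTprime W p → ¬ W.HasIrreducibleModPGaloisRep p →
      ¬ ((∀ (W' : WeierstrassCurve ℚ) [W'.IsElliptic], IsIsogenous W W' → ¬ p ^ 2 ∣ W'.torsionOrder) ∧
          ∀ q : ℚ, shaAn W = (q : ℂ) → Even (padicValRat p q)) →
      MissingUpperBoundAt W p :=
  ReducibleUpperOfCountInputs.tameUpperReducibleDefect_body Kato2004.nonempty_iwasawaH1Data_holds hmod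
    (exists_memberHullCountInputs_of_countValue h hGZK) hCassels hGZK hmodL

end Summit.BirchSwinnertonDyer.BirchSwinnertonDyer.Theorems.ReducibleOfCountValueInputs

end
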